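import Summits.QuantumFields.BalabanUV.T4Continuum.Spine.NE7c.LiveFactorLargeField
import Literature.MathematicalPhysics.QuantumFieldTheory.Balaban1983to89.B16Ineq182Gluing
import Literature.MathematicalPhysics.QuantumFieldTheory.Balaban1983to89.B16Lem384Induction

/-!
# `T4Continuum.Spine.NE7c.LiveFactorKappaInduction` — spine estimate NE7c (node U5b), road (δ) THRESHOLD RANDOMISATION:
# the (L1-step) census's loss class C1 DOWNSTREAM of the large-field factors — [B16] pp. 384–387, the `κ_j(Z)`-induction
# (1.80)–(1.88) and its located condition of p. 385 — read with the live factor, IN KERNEL FORM against the tree's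
# as-printed leaves (cell `pub-balaban-gaps`, track G2, seat ne8 gen 3; record `HOME/ne/NE7c.md` §7 row 18, §10)

HONEST FRAMING.  Finite four-torus programme, rung (B)+1 only — NOT infinite volume, NOT a mass gap, NOT the Clay
problem, NOT summit progress, NOT a proof of NE7c (`T4IndicatorShell.ShellWeightBound`, INSTANCE 0∕1, which waits on
node O).  Nothing of [Bałaban 1983–89] is asserted beyond print: every input below is an explicit hypothesis of the
tree's quoted leaves (`B16Ineq182Gluing` §4–§5 = (1.82) and the base case of (1.80) p. 385; `B16Lem384Induction` §8 =
«the first induction step» in the cell's ℤᵈ index model with print's located condition `hcond` as its ONLY located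
input), and what is PROVED is real arithmetic about those displays.  This file does NOT verify that C1 is the census's
only loss class (the completeness of the (L1-step) census over [B14]–[B16] is NOT PRINTED, GAPS G-ne7cp1-2).  Spine
PROVED 0∕9 — unchanged by this file.

WHERE THIS SITS (companion `…Spine.NE7c.LiveFactorLargeField`, p340750).  Road (δ) lowers every LIVE small-field
threshold of one run by a common factor `λ ∈ [λ₀, 1]`, `λ₀ = 1 − β′`; in the [III] (2.2)–(2.4) dictionary this is the
substitution `A₁ ↦ μA₁` (`μ ∈ [λ₀, 1]` per threshold) in the Gaussian amplitudes.  The companion file proved that the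
large-field factors PRODUCED on [B16] pp. 380–383 survive with `A₁ ↦ λ₀A₁` in the amplitudes and print's bookkeeping
`p₀(g_j)` verbatim, uniformly in `μ`, and recorded as «a remark, not a theorem» that the `κ_j(Z)`-induction CONSUMING
those factors (pp. 384–387) runs unchanged at the amplitude `λ₀A₁` once its located condition is certified there.  THIS
FILE makes that remark a theorem and prices it:
* §1 (1.82) LIVE (`ineq182_live`): the definition-lower-bound of `κ₁(Z)` written with the ACTUAL live amplitude `μA₁` of
  the component's regions gives print's (1.82) with `A₁ ↦ λ₀A₁`, uniformly in `μ ≥ λ₀` (`Lit.B16Ineq182Gluing.ineq182_of_def`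
  + monotonicity in the amplitude); the base case of (1.80) BY NAME (`controls_base_live` =
  `Lit.B16Ineq182Gluing.controls_base_of_def` with the located condition asked ONCE at `λ₀A₁`).
* §2 THE LOCATED CONDITION p. 385 «¼γ₀(14)^{−d}A₁²p₀²(g₁) ≧ O(1)2(64)^dM^dL^{d+1}R₁^{d+2}. This condition is satisfied for p₀
  large, and g₁ sufficiently small» (render-checked by this seat, `…large-field-II-p031-x2.png`) read with `A₁ ↦ λ₀A₁`:
  `locatedCondition385_of_g_small` — for (2.5)'s `R_m` (`Lit.B14.IsRj L r g_m R_m`) and ANY cost exponent `n` with the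
  exponent room `n·r < 2p₀` («p₀ large»), there is an explicit `g₀ = g₀(λ₀, …) > 0` below which the condition holds at
  amplitude `λ₀A₁` (hence at every `μA₁`, `μ ≥ λ₀`: `locatedCondition385_live`); and `exponentRoom_of_proviso383` — for the
  printed cost exponent `n = d + 2` the room is IMPLIED by the p. 383 strict proviso «2p₁ − (d + 5)r₀ > p₀»
  (`Lit.B16Sect1Kernels.ExponentProviso383`) together with [B15] p. 183 l. 1 «p₁ < p₀» (used as `p₁ ≤ p₀`): NO exponent condition beyond print's.
* §3 JUNCTION BY NAME with the index model: `hcond_ofIndex_of_g_small` delivers `Lit.B16Lem384Induction.exists_birth_ofIndex`'s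
  ONLY located input `hcond` in its literal shape (cell constant `10·126^d`) at amplitude `λ₀A₁` below `g₀(λ₀)`;
  `controls_ofIndex_live` = `Lit.B16Lem384Induction.controls_ofIndex` ((1.80) at the creation scale, end to end in the
  index model) for the bracket `¼γ₀(14)^{−d}(μA₁)²p₀²(g_m)·(d′_m(Z) + 1)` of EVERY live amplitude `μ ≥ λ₀` from the condition
  at `λ₀`; `fundIneq189_ofIndex_live` = `Lit.B16Lem384Induction.fundIneq189_ofIndex`: (1.89) VERBATIM at every later scale for
  every horizon-`0` component, from base data whose components were born at their own live amplitudes `μ_Z ≥ λ₀` and the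
  condition at `λ₀`.  The merger (1.85)–(1.88) and its budget condition «for p₀ large and γ small enough»
  (`Lit.B16Lem384Induction.MergeIndex.hbudget : E + cost(2) ≤ 2(1+β₀)⁻¹p₀(g_{j+1})`), the continuation (1.83), the reset of
  p. 386 and the conclusion (1.89) `𝐓′_k(X)1 ≦ exp(−2(1+β₀)⁻¹p₀(g_k))` do not see the amplitude `A₁` at all (they are stated
  in the bookkeeping profile `p₀(g)` and the costs only; each new piece of a merger carries its OWN bracket coefficient
  `Birth.a`, so mixed live∕dead amplitudes are already covered by the model) — so (1.89), the one output of pp. 384–389 that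
  [B16] Thm 1 consumes, is INVARIANT under road (δ)'s live factor; the factor is visible only in the two «g small» clauses
  (p. 383 proviso → companion `liveFactor383_of_g_small`; p. 385 located condition → §2 here), both asked once at `λ₀`.
* §4 SHARPNESS (why the companion needed the STRICT proviso): at the boundary `p₀ = 2p₁ − (d + 5)r₀` of the p. 383 proviso,
  with `R_j = ℓ^{r₀}` exactly, the lowered-threshold factor is NOT estimated by print's kept factor for ANY `g_j` as soon as
  `λ₀²A₁² < A₀` (`liveFactor_not_absorbed_at_boundary`, `exp_kept_lt_exp_live_at_boundary`): road (δ) consumes exactly the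
  strictness of the printed inequality — the tree's pre-existing non-strict reading
  (`Lit.B16Sect1Kernels.exp_lfFactor_le_exp_neg_p0`, `A₀ = A₁ = μ = 1`) has no room for a live factor `< 1`.
* §5 sanity: the room and the proviso are jointly inhabited with `p₁ ≤ p₀` (`d = 4`: `p₀ = p₁ = 10`, `r₀ = 1`).
NOT HERE: node O, U1b's two-run rate, (W1), the convention item C5′; no `def … : Prop` hypothesis is minted; 0 sorry.
-/

namespace Summit.QuantumFields.BalabanUV.T4Continuum.Spine.NE7c.LiveFactorKappaInduction

open Literature.MathematicalPhysics.QuantumFieldTheory.Balaban1983to89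
open B13ScaleTransfer TreeLength B16Sect1Kernels B16Ineq182Gluing B16Lem384Induction B16SProfile B16StoppingRule
open Step Step.Budget
open Summit.QuantumFields.BalabanUV.T4Continuum.Spine.NE7c.LiveFactorLargeField

noncomputable section

/-! ## §1. (1.82) and the base case of (1.80) with a live amplitude -/

/-- **[B16] (1.82) p. 385, LIVE.**  If the regions `Z₁⁽ⁱ⁾` determining the component `Z` were born with their thresholds
(`ε₁`, `δ₁`: member (δ-1) lowers every kind at a live level by the same factor) lowered by `μ ∈ [λ₀, 1]` — so that the
(1.79)-shaped definition of `κ₁(Z)` reads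
`κ₁(Z) ≧ Σ_i ½γ₀(μA₁)²p₀²(g₁)(d′₁(Z₁⁽ⁱ⁾) + 1) − O(1)M^dR₁^{d+1}d′₁(Z)` (`hdef`, the companion's `fundamentalFactor_le_live`
exponent) — then print's gluing (cover `hcover`, enlargement `henl`, `Lit.B16Ineq182Gluing.ineq182_of_def`) gives (1.82) with
`A₁ ↦ λ₀A₁`, UNIFORMLY in `μ ≥ λ₀ ≥ 0`:
`κ₁(Z) ≧ ¼γ₀(14)^{−d}(λ₀A₁)²p₀²(g₁)(d′₁(Z) + 1) − O(1)M^dR₁^{d+1}d′₁(Z)`. [folklore] -/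
theorem ineq182_live {ι : Type*} {s : Finset ι} (hs : s.Nonempty) {d : ℕ}
    {κ₁ dZ γ₀ A₁ p₀g cost lam₀ μ : ℝ} {d₁ e : ι → ℝ} (hγ : 0 ≤ γ₀) (hdZ : 0 ≤ dZ) (h0 : 0 ≤ lam₀)
    (hμ : lam₀ ≤ μ)
    (hdef : ∑ i ∈ s, (1 / 2) * γ₀ * (μ * A₁) ^ 2 * p₀g ^ 2 * (d₁ i + 1) - cost ≤ κ₁)
    (hcover : dZ ≤ ∑ i ∈ s, e i) (henl : ∀ i ∈ s, e i ≤ 2 * 14 ^ d * (d₁ i + 1 / 2)) :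
    (1 / 4) * γ₀ * (14 ^ d)⁻¹ * (lam₀ * A₁) ^ 2 * p₀g ^ 2 * (dZ + 1) - cost ≤ κ₁ := by
  have h := ineq182_of_def hs hγ hdef hcover henl
  have hsq : (lam₀ * A₁) ^ 2 ≤ (μ * A₁) ^ 2 := by
    rw [mul_pow, mul_pow]
    exact mul_le_mul_of_nonneg_right (pow_le_pow_left₀ h0 hμ 2) (sq_nonneg _)
  have hw : 0 ≤ (1 / 4) * γ₀ * (14 ^ d)⁻¹ * p₀g ^ 2 * (dZ + 1) := by positivity
  have key : (1 / 4) * γ₀ * (14 ^ d)⁻¹ * (lam₀ * A₁) ^ 2 * p₀g ^ 2 * (dZ + 1) ≤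
      (1 / 4) * γ₀ * (14 ^ d)⁻¹ * (μ * A₁) ^ 2 * p₀g ^ 2 * (dZ + 1) := by
    have := mul_le_mul_of_nonneg_left hsq hw
    calc (1 / 4) * γ₀ * (14 ^ d)⁻¹ * (lam₀ * A₁) ^ 2 * p₀g ^ 2 * (dZ + 1)
        = (1 / 4) * γ₀ * (14 ^ d)⁻¹ * p₀g ^ 2 * (dZ + 1) * (lam₀ * A₁) ^ 2 := by ring
      _ ≤ (1 / 4) * γ₀ * (14 ^ d)⁻¹ * p₀g ^ 2 * (dZ + 1) * (μ * A₁) ^ 2 := this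
      _ = (1 / 4) * γ₀ * (14 ^ d)⁻¹ * (μ * A₁) ^ 2 * p₀g ^ 2 * (dZ + 1) := by ring
  linarith

/-- **The located condition of p. 385 is MONOTONE in the live factor** (census class C1: asked ONCE, at the bottom `λ₀` of
the factor's range): `2Q ≦ ¼γ₀(14)^{−d}(λ₀A₁)²p₀²` and `0 ≦ λ₀ ≦ μ` give `2Q ≦ ¼γ₀(14)^{−d}(μA₁)²p₀²`
(the companion's `clause_live`). [folklore] -/
theorem locatedCondition385_live {Q γ₀ A₁ p₀g lam₀ μ : ℝ} {d : ℕ} (hγ : 0 ≤ γ₀) (h0 : 0 ≤ lam₀) (hμ : lam₀ ≤ μ)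
    (hcond : 2 * Q ≤ (1 / 4) * γ₀ * (14 ^ d)⁻¹ * (lam₀ * A₁) ^ 2 * p₀g ^ 2) :
    2 * Q ≤ (1 / 4) * γ₀ * (14 ^ d)⁻¹ * (μ * A₁) ^ 2 * p₀g ^ 2 :=
  clause_live (by positivity) (sq_nonneg _) h0 hμ hcond

/-- **THE BASE CASE `j = 1` OF (1.80), LIVE, BY NAME** (p. 385 «Thus, by the estimate (1.81), the statement holds for
j = 1, … if [the located condition]»): `Lit.B16Ineq182Gluing.controls_base_of_def` — the cell's `Step.Budget.Controls b 1 K κ₁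
size` from the definition of `κ₁(Z)`, the gluing binders, the (1.81) majorant `h181`, the cost bound `hcost` — for regions
born at the live amplitude `μA₁` (`hdef`), with the located condition asked ONCE at `λ₀A₁` (`hcond₀`) and transported to
`μ ≥ λ₀` by `locatedCondition385_live`. [folklore] -/
theorem controls_base_live (b : Step.Budget.Consts) {ι : Type*} {s : Finset ι} (hs : s.Nonempty)
    {κ₁ dZ γ₀ A₁ p₀g Q lam₀ μ : ℝ} {d₁ e : ι → ℝ} {K : ℕ} {size : ℕ → ℝ} (hγ : 0 ≤ γ₀) (hdZ : 0 ≤ dZ)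
    (h0 : 0 ≤ lam₀) (hμ : lam₀ ≤ μ)
    (hdef : ∑ i ∈ s, (1 / 2) * γ₀ * (μ * A₁) ^ 2 * p₀g ^ 2 * (d₁ i + 1) - b.cost 1 dZ ≤ κ₁)
    (hcover : dZ ≤ ∑ i ∈ s, e i) (henl : ∀ i ∈ s, e i ≤ 2 * 14 ^ b.d * (d₁ i + 1 / 2))
    (h181 : ∑ n ∈ Finset.Ioc 1 (1 + K), b.cost n (size n) ≤ Q * (dZ + 1))
    (hcost : b.cost 1 dZ ≤ Q * (dZ + 1))
    (hcond₀ : 2 * Q ≤ (1 / 4) * γ₀ * (14 ^ b.d)⁻¹ * (lam₀ * A₁) ^ 2 * p₀g ^ 2) :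
    Step.Budget.Controls b 1 K κ₁ size :=
  controls_base_of_def b hs hγ hdZ hdef hcover henl h181 hcost (locatedCondition385_live hγ h0 hμ hcond₀)

/-! ## §2. The located condition of p. 385 «for p₀ large, and g₁ sufficiently small», read with `A₁ ↦ λ₀A₁` -/

/-- **THE EXPONENT ROOM IS PRINT'S.**  «This condition is satisfied for p₀ large»: comparing `p₀²(g) ∝ (log g⁻²)^{2p₀}` with
`R^{d+2} ≦ L^{d+2}(log g⁻²)^{(d+2)r₀}` ((2.5) [III]) needs the room `(d + 2)r₀ < 2p₀`; it is IMPLIED by the strict proviso of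
p. 383 «2p₁ − (d + 5)r₀ > p₀» (`Lit.B16Sect1Kernels.ExponentProviso383`) and [B15] p. 183 l. 1 «δ′_j = g_jA₁p₁(g_j),
p₁(g_j) = (log g_j⁻²)^{p₁}, and p₁ < p₀» (render-checked; used as `p₁ ≦ p₀`)
(`2p₀ ≧ 2p₁ > p₀ + (d + 5)r₀`, so `(d + 2)r₀ ≦ (d + 5)r₀ < p₀ ≦ 2p₀`).  No exponent condition beyond print's. [folklore] -/
theorem exponentRoom_of_proviso383 {p₀ p₁ r d : ℕ} (hprov : ExponentProviso383 p₀ p₁ r d) (hp : p₁ ≤ p₀) :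
    (d + 2) * r < 2 * p₀ := by
  unfold ExponentProviso383 at hprov
  have hp' : (p₁ : ℝ) ≤ p₀ := by exact_mod_cast hp
  have hr : (0 : ℝ) ≤ r := Nat.cast_nonneg r
  have hd : (0 : ℝ) ≤ d := Nat.cast_nonneg d
  have h : ((d : ℝ) + 2) * r < 2 * p₀ := by nlinarith
  exact_mod_cast h

/-- **[B16] p. 385, the located condition with a live amplitude, «for g₁ sufficiently small» made explicit.**  Let `R` be
given by (2.5) [III] (`Lit.B14.IsRj L r g R`, `L ≥ 1`), the bookkeeping profile by (2.4) [III]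
(`Lit.p0Profile A₀ p₀ g = A₀(log g⁻²)^{p₀}`, `A₀ > 0`), let the cost side be `W·R^n` with ANY `W ≥ 0` and cost exponent `n`
(print: `W = O(1)2(64)^dM^dL^{d+1}`, `n = d + 2`; cell: `W = 10·126^d·O(1)M^{d_b}L^{d_b+1}`, `n = d_b + 2`), the bracket side
`K_c(λ₀A₁)²p₀²(g)` with ANY `K_c > 0` (print: `¼γ₀(14)^{−d}`), and assume the exponent room `n·r < 2p₀`
(`exponentRoom_of_proviso383`).  Then there is `g₀ = g₀(λ₀, W, K_c, A₀, A₁, L, n) > 0` — explicitly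
`exp(−½·max{1, 2WL^n∕(K_c(λ₀A₁)²A₀²)})` — such that for all `0 < g ≦ g₀`: `2·W·R^n ≦ K_c(λ₀A₁)²p₀²(g)`.  ONE smallness of
`g` depending on the slack `λ₀ = 1 − β′` (and print's constants) only. [folklore] -/
theorem locatedCondition385_of_g_small {L r p₀ n : ℕ} {W Kc A₀ A₁ lam₀ : ℝ} (hL : 1 ≤ L) (hW : 0 ≤ W)
    (hK : 0 < Kc) (hA₀ : 0 < A₀) (hA₁ : 0 < A₁) (h0 : 0 < lam₀) (hroom : n * r < 2 * p₀) :
    ∃ g₀ : ℝ, 0 < g₀ ∧ ∀ (g : ℝ) (R : ℕ), 0 < g → g ≤ g₀ → B14.IsRj L r g R →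
      2 * (W * (R : ℝ) ^ n) ≤ Kc * (lam₀ * A₁) ^ 2 * (p0Profile A₀ p₀ g) ^ 2 := by
  set D : ℝ := Kc * (lam₀ * A₁) ^ 2 * A₀ ^ 2 with hDdef
  have hD : 0 < D := by positivity
  set c : ℝ := 2 * W * (L : ℝ) ^ n / D with hcdef
  have hL' : (1 : ℝ) ≤ (L : ℝ) := by exact_mod_cast hL
  have hL0 : (0 : ℝ) ≤ (L : ℝ) := by positivity
  have hc : 0 ≤ c := by positivity
  set ℓ₀ : ℝ := max 1 c with hℓ₀def
  refine ⟨Real.exp (-(ℓ₀ / 2)), Real.exp_pos _, fun g R hg0 hg hR => ?_⟩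
  -- the logarithm `ℓ = log g⁻²` is beyond the threshold
  have hℓ : ℓ₀ ≤ Real.log (g ^ 2)⁻¹ := B16Sect1SmallFactors.ell_ge_of_g_le hg0 hg
  set ℓ : ℝ := Real.log (g ^ 2)⁻¹ with hℓdef
  have hℓ1 : 1 ≤ ℓ := le_trans (le_max_left _ _) hℓ
  have hℓc : c ≤ ℓ := le_trans (le_max_right _ _) hℓ
  have hℓ0 : 0 ≤ ℓ := zero_le_one.trans hℓ1
  -- the (2.5) bracket `R ≤ L ℓ^r`
  obtain ⟨-, hRhi⟩ := B16Sect1SmallFactors.dict_of_isRj hL hR hℓ1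
  rw [Real.rpow_natCast] at hRhi
  have hR0 : (0 : ℝ) ≤ (R : ℝ) := Nat.cast_nonneg R
  have hRn : (R : ℝ) ^ n ≤ (L : ℝ) ^ n * ℓ ^ (n * r) := by
    calc (R : ℝ) ^ n ≤ ((L : ℝ) * ℓ ^ r) ^ n := pow_le_pow_left₀ hR0 hRhi n
      _ = (L : ℝ) ^ n * ℓ ^ (n * r) := by rw [mul_pow, ← pow_mul, mul_comm r n]
  -- the room: `ℓ^{2p₀} ≥ ℓ · ℓ^{nr} ≥ c · ℓ^{nr}`
  have hpow : c * ℓ ^ (n * r) ≤ ℓ ^ (2 * p₀) := by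
    have h1 : ℓ ^ (n * r + 1) ≤ ℓ ^ (2 * p₀) := pow_le_pow_right₀ hℓ1 (by omega)
    calc c * ℓ ^ (n * r) ≤ ℓ * ℓ ^ (n * r) := mul_le_mul_of_nonneg_right hℓc (pow_nonneg hℓ0 _)
      _ = ℓ ^ (n * r + 1) := by ring
      _ ≤ ℓ ^ (2 * p₀) := h1
  -- assemble
  have hprof : (p0Profile A₀ p₀ g) ^ 2 = A₀ ^ 2 * ℓ ^ (2 * p₀) := by
    rw [p0Profile, ← hℓdef, mul_pow, ← pow_mul, mul_comm p₀ 2]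
  have hDc : D * c = 2 * W * (L : ℝ) ^ n := by
    rw [hcdef, mul_div_cancel₀ _ hD.ne']
  calc 2 * (W * (R : ℝ) ^ n) ≤ 2 * (W * ((L : ℝ) ^ n * ℓ ^ (n * r))) := by
        have := mul_le_mul_of_nonneg_left hRn hW
        linarith
    _ = (D * c) * ℓ ^ (n * r) := by rw [hDc]; ring
    _ = D * (c * ℓ ^ (n * r)) := by ring
    _ ≤ D * ℓ ^ (2 * p₀) := mul_le_mul_of_nonneg_left hpow hD.le
    _ = Kc * (lam₀ * A₁) ^ 2 * (A₀ ^ 2 * ℓ ^ (2 * p₀)) := by rw [hDdef]; ring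
    _ = Kc * (lam₀ * A₁) ^ 2 * (p0Profile A₀ p₀ g) ^ 2 := by rw [hprof]

/-! ## §3. Junction BY NAME with the index model of `Lit.B16Lem384Induction` §8 -/

/-- **The ONLY located input of `Lit.B16Lem384Induction.exists_birth_ofIndex`, delivered at a live amplitude below an
explicit threshold.**  In that theorem's literal currency — `hcond : 2·(10·126^d·(O(1)·M^{d_b}·L^{d_b+1}·R_m^{d_b+2})) ≦ a` —
and with the bracket coefficient of (1.82) at amplitude `λ₀A₁`, `a = ¼γ₀(14)^{−d_b}(λ₀A₁)²p₀²(g_m)`: under the exponent room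
`(d_b + 2)·r < 2p₀` there is `g₀(λ₀, …) > 0` such that `hcond` holds whenever `0 < g_m ≦ g₀` and `R_m` is (2.5)'s
(`Lit.B14.IsRj L r g_m R_m`; the consumer rewrites `b.R m = R_m` by its own `hbR`). [folklore] -/
theorem hcond_ofIndex_of_g_small (b : Step.Budget.Consts) {L r p₀ d : ℕ} (hL : 1 ≤ L) (hC : 0 ≤ b.C)
    (hM : 0 ≤ b.M) {γ₀ A₀ A₁ lam₀ : ℝ} (hγ : 0 < γ₀) (hA₀ : 0 < A₀) (hA₁ : 0 < A₁) (h0 : 0 < lam₀)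
    (hroom : (b.d + 2) * r < 2 * p₀) :
    ∃ g₀ : ℝ, 0 < g₀ ∧ ∀ (gm : ℝ) (Rm : ℕ), 0 < gm → gm ≤ g₀ → B14.IsRj L r gm Rm →
      2 * (10 * 126 ^ d * (b.C * b.M ^ b.d * (L : ℝ) ^ (b.d + 1) * (Rm : ℝ) ^ (b.d + 2))) ≤
        (1 / 4) * γ₀ * (14 ^ b.d)⁻¹ * (lam₀ * A₁) ^ 2 * (p0Profile A₀ p₀ gm) ^ 2 := by
  have hW : (0 : ℝ) ≤ 10 * 126 ^ d * (b.C * b.M ^ b.d * (L : ℝ) ^ (b.d + 1)) := by positivity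
  have hK : (0 : ℝ) < (1 / 4) * γ₀ * (14 ^ b.d)⁻¹ := by positivity
  obtain ⟨g₀, hg₀, h⟩ := locatedCondition385_of_g_small (n := b.d + 2) hL hW hK hA₀ hA₁ h0 hroom
  refine ⟨g₀, hg₀, fun gm Rm hg0 hg hR => ?_⟩
  have h1 := h gm Rm hg0 hg hR
  calc 2 * (10 * 126 ^ d * (b.C * b.M ^ b.d * (L : ℝ) ^ (b.d + 1) * (Rm : ℝ) ^ (b.d + 2)))
      = 2 * (10 * 126 ^ d * (b.C * b.M ^ b.d * (L : ℝ) ^ (b.d + 1)) * (Rm : ℝ) ^ (b.d + 2)) := by ring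
    _ ≤ (1 / 4) * γ₀ * (14 ^ b.d)⁻¹ * (lam₀ * A₁) ^ 2 * (p0Profile A₀ p₀ gm) ^ 2 := h1

/-- **(1.80) AT THE CREATION SCALE IN THE INDEX MODEL, LIVE, BY NAME** (`Lit.B16Lem384Induction.controls_ofIndex`): for a
non-empty face-connected region `Z` born at scale `m` of a flow obeying (2.5)∕(2.7)∕(2.9a) [III], with a horizon `K` inside
the flow not exceeding any stopping index, the located condition certified ONCE at the amplitude `λ₀A₁` (`hcond₀`, e.g. by
`hcond_ofIndex_of_g_small`) yields, for EVERY live amplitude `μA₁`, `μ ≥ λ₀` — the actual bracket of a region born with its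
fluctuation threshold lowered by `μ` — that the (1.82)-budget `¼γ₀(14)^{−d_b}(μA₁)²p₀²(g_m)·(d′_m(Z) + 1) − O(1)M^dR_m^{d+1}d′_m(Z)`
CONTROLS the `K` steps of `Z` (`Step.Budget.Controls` for the tree-length profile of the `S`-iterates).  Every binder except
`hcond₀`, `h0`, `hμ`, `hγ` is `controls_ofIndex`'s verbatim. [folklore] -/
theorem controls_ofIndex_live (b : Budget.Consts) {L p Kf d : ℕ} (hL : 4 ≤ L) {g : ℕ → ℝ} {γ β' β₀ : ℝ}
    (hI : Step.InInterval γ Kf g) (hγ1 : γ ≤ 1) (R : ℕ → ℕ)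
    (hR : ∀ n, n ≤ Kf → B14.IsRj L p (g n) (R n)) (hbR : ∀ n, n ≤ Kf → b.R n = (R n : ℝ))
    (h29a : ∀ m n, m < n → n ≤ Kf → (R n : ℝ) ≤ L * R m) (h27 : B14.FlowIneq27 g β' β₀ p Kf)
    (hΘ : ∀ m n, m < n → n ≤ Kf → (1 + (g n) ^ 2 * β' * ((n : ℝ) - m)) ^ β₀ ≤ (L : ℝ) ^ (max (n - m) 2 / 2))
    (hC : 0 ≤ b.C) (hM : 0 ≤ b.M) {Z : Finset (Pt d)} (hZ : Z.Nonempty) (hZc : FaceConnected Z)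
    (m K : ℕ) (hmK : m + K ≤ Kf) (Nsz : ℕ) (hNsz : 64 ≤ Nsz) (Clean : ℕ → Prop)
    (hclean : ∀ l, 1 ≤ l → l ≤ Kf - m → Clean l)
    (hKmin : ∀ K', StopAt Nsz (R m) Clean (fun i => Siter (ratio L (fun i => Nat.log L (R (m + i)))) i Z) K' → K ≤ K')
    {γ₀ A₀ A₁ lam₀ μ : ℝ} {p₀ : ℕ} (hγ : 0 ≤ γ₀) (h0 : 0 ≤ lam₀) (hμ : lam₀ ≤ μ)
    (hcond₀ : 2 * (10 * 126 ^ d * (b.C * b.M ^ b.d * (L : ℝ) ^ (b.d + 1) * b.R m ^ (b.d + 2))) ≤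
      (1 / 4) * γ₀ * (14 ^ b.d)⁻¹ * (lam₀ * A₁) ^ 2 * (p0Profile A₀ p₀ (g m)) ^ 2) :
    Controls b m K
      ((1 / 4) * γ₀ * (14 ^ b.d)⁻¹ * (μ * A₁) ^ 2 * (p0Profile A₀ p₀ (g m)) ^ 2 * (treeLen Z + 1) -
        b.cost m (treeLen Z))
      (fun n => treeLen (Siter (ratio L (fun i => Nat.log L (R (m + i)))) (n - m) Z)) :=
  controls_ofIndex b hL hI hγ1 R hR hbR h29a h27 hΘ hC hM hZ hZc m K hmK Nsz hNsz Clean hclean hKmin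
    ((1 / 4) * γ₀ * (14 ^ b.d)⁻¹ * (μ * A₁) ^ 2 * (p0Profile A₀ p₀ (g m)) ^ 2)
    (locatedCondition385_live hγ h0 hμ hcond₀)

/-- **(1.80) is monotone in the bracket**: the budget certified at the amplitude `λ₀A₁` is BELOW the actual budget of a
region born at any `μA₁`, `μ ≥ λ₀ ≥ 0` (sizes `d′ ≥ 0`), so whatever the former controls, the latter controls
(`Lit.B16Lem384Induction.controls_mono_κ`) — the form in which the downstream induction (1.83)∕(1.85)∕p. 386, which never
reads the amplitude, inherits the live bracket. [folklore] -/
theorem controls_live_of_controls_at_floor (b : Budget.Consts) (m K : ℕ) {γ₀ A₁ P dZ cost lam₀ μ : ℝ} {d : ℕ}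
    (size : ℕ → ℝ) (hγ : 0 ≤ γ₀) (hP : 0 ≤ P) (hdZ : 0 ≤ dZ) (h0 : 0 ≤ lam₀) (hμ : lam₀ ≤ μ)
    (h : Controls b m K ((1 / 4) * γ₀ * (14 ^ d)⁻¹ * (lam₀ * A₁) ^ 2 * P * (dZ + 1) - cost) size) :
    Controls b m K ((1 / 4) * γ₀ * (14 ^ d)⁻¹ * (μ * A₁) ^ 2 * P * (dZ + 1) - cost) size := by
  refine controls_mono_κ b m K size h ?_
  have hsq : (lam₀ * A₁) ^ 2 ≤ (μ * A₁) ^ 2 := by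
    rw [mul_pow, mul_pow]
    exact mul_le_mul_of_nonneg_right (pow_le_pow_left₀ h0 hμ 2) (sq_nonneg _)
  have hw : 0 ≤ (1 / 4) * γ₀ * (14 ^ d)⁻¹ * P * (dZ + 1) := by positivity
  have := mul_le_mul_of_nonneg_left hsq hw
  nlinarith

/-- **(1.89) VERBATIM UNDER THE LIVE FACTOR, END TO END, BY NAME** (`Lit.B16Lem384Induction.fundIneq189_ofIndex`).  Base
data at scale `j₀` read from index regions whose components were born at THEIR OWN live amplitudes `μ_Z·A₁`, `μ_Z ≥ λ₀` —
so that each actual budget dominates its own (1.82)-bracket, `¼γ₀(14)^{−d_b}(μ_Z A₁)²p₀²(g_{j₀})·(d′(Z) + 1) − cost ≦ κ(Z)`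
(`h182μ`) —, the located condition asked ONCE at `λ₀A₁` (`hcond₀`), and a printed-case transition at every later scale give
the fundamental inequality (1.89) `𝐓′_k(X)1 ≦ exp(−2(1+β₀)⁻¹p₀(g_k))` for every horizon-`0` component at every scale `k ≥ j₀`
— print's conclusion with NO trace of the live factor (its right side never saw `A₁`).  Every other binder is
`fundIneq189_ofIndex`'s verbatim; the floor bracket `a(λ₀)` serves as its `a`, each `κ(Z)` dominating it by monotonicity in
`μ_Z`. [folklore] -/
theorem fundIneq189_ofIndex_live (b : Budget.Consts) (D : (j : ℕ) → ScaleData j) (j₀ : ℕ) {L p Kf d : ℕ} (hL : 4 ≤ L)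
    {g : ℕ → ℝ} {γ β' β₀f : ℝ} (hI : Step.InInterval γ Kf g) (hγ1 : γ ≤ 1) (R : ℕ → ℕ)
    (hR : ∀ n, n ≤ Kf → B14.IsRj L p (g n) (R n)) (hbR : ∀ n, n ≤ Kf → b.R n = (R n : ℝ))
    (h29a : ∀ m n, m < n → n ≤ Kf → (R n : ℝ) ≤ L * R m) (h27 : B14.FlowIneq27 g β' β₀f p Kf)
    (hΘ : ∀ m n, m < n → n ≤ Kf → (1 + (g n) ^ 2 * β' * ((n : ℝ) - m)) ^ β₀f ≤ (L : ℝ) ^ (max (n - m) 2 / 2))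
    (hC : 0 ≤ b.C) (hM : 0 ≤ b.M) (reg : (D j₀).Comp → Finset (Pt d)) (hne : ∀ Z, (reg Z).Nonempty)
    (hfc : ∀ Z, FaceConnected (reg Z)) (hKf : ∀ Z, j₀ + (D j₀).K Z ≤ Kf) (Nsz : ℕ) (hNsz : 64 ≤ Nsz)
    (Clean : (D j₀).Comp → ℕ → Prop) (hclean : ∀ Z l, 1 ≤ l → l ≤ Kf - j₀ → Clean Z l)
    (hKmin : ∀ Z K', StopAt Nsz (R j₀) (Clean Z)
      (fun i => Siter (ratio L (fun i => Nat.log L (R (j₀ + i)))) i (reg Z)) K' → (D j₀).K Z ≤ K')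
    (hsize : ∀ Z, (D j₀).size Z =
      fun n => treeLen (Siter (ratio L (fun i => Nat.log L (R (j₀ + i)))) (n - j₀) (reg Z)))
    {γ₀ A₀ A₁ lam₀ : ℝ} {p₀ : ℕ} (hγ : 0 ≤ γ₀) (h0 : 0 ≤ lam₀)
    (hcond₀ : 2 * (10 * 126 ^ d * (b.C * b.M ^ b.d * (L : ℝ) ^ (b.d + 1) * b.R j₀ ^ (b.d + 2))) ≤
      (1 / 4) * γ₀ * (14 ^ b.d)⁻¹ * (lam₀ * A₁) ^ 2 * (p0Profile A₀ p₀ (g j₀)) ^ 2)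
    (h182μ : ∀ Z, ∃ μ : ℝ, lam₀ ≤ μ ∧
      (1 / 4) * γ₀ * (14 ^ b.d)⁻¹ * (μ * A₁) ^ 2 * (p0Profile A₀ p₀ (g j₀)) ^ 2 * (treeLen (reg Z) + 1) -
        b.cost j₀ (treeLen (reg Z)) ≤ (D j₀).κ Z)
    (T : ∀ j, j₀ ≤ j → Transition b (D j) (D (j + 1))) {k : ℕ} (hk : j₀ ≤ k) (X : (D k).Comp) (hK : (D k).K X = 0)
    {V : Type*} (T1X : V → ℝ) (A₀' : ℝ) (p₀' : ℕ) (β₀ gk Pj : ℝ)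
    (hT : ∀ v, T1X v ≤ Real.exp (-(D k).κ X - Pj)) (hP : 2 * (1 + β₀)⁻¹ * p0Profile A₀' p₀' gk ≤ Pj) :
    FundIneq189 T1X A₀' p₀' β₀ gk := by
  refine fundIneq189_ofIndex b D j₀ hL hI hγ1 R hR hbR h29a h27 hΘ hC hM reg hne hfc hKf Nsz hNsz Clean hclean hKmin
    hsize ((1 / 4) * γ₀ * (14 ^ b.d)⁻¹ * (lam₀ * A₁) ^ 2 * (p0Profile A₀ p₀ (g j₀)) ^ 2) hcond₀ ?_ T hk X hK T1X A₀'
    p₀' β₀ gk Pj hT hP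
  intro Z
  obtain ⟨μ, hμ, hZ⟩ := h182μ Z
  refine le_trans ?_ hZ
  have hsq : (lam₀ * A₁) ^ 2 ≤ (μ * A₁) ^ 2 := by
    rw [mul_pow, mul_pow]
    exact mul_le_mul_of_nonneg_right (pow_le_pow_left₀ h0 hμ 2) (sq_nonneg _)
  have hw : 0 ≤ (1 / 4) * γ₀ * (14 ^ b.d)⁻¹ * (p0Profile A₀ p₀ (g j₀)) ^ 2 * (treeLen (reg Z) + 1) := by
    have := treeLen_nonneg (reg Z)
    positivity
  have := mul_le_mul_of_nonneg_left hsq hw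
  nlinarith

/-! ## §4. Sharpness: at the boundary of the p. 383 proviso the live factor is NOT absorbed -/

/-- Real powers of real powers with a natural outer exponent: `(ℓ^a)^n = ℓ^{n·a}` (`ℓ ≥ 0`). [folklore] -/
private theorem rpow_pow_eq {ℓ : ℝ} (hℓ : 0 ≤ ℓ) (a : ℝ) (n : ℕ) : (ℓ ^ a) ^ n = ℓ ^ ((n : ℝ) * a) := by
  rw [← Real.rpow_natCast (ℓ ^ a) n, ← Real.rpow_mul hℓ, mul_comm]

/-- **SHARPNESS OF THE COMPANION'S USE OF THE STRICT PROVISO.**  At the BOUNDARY `p₀ = 2p₁ − (d + 5)r₀` of [B16] p. 383's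
proviso (the non-strict reading), with `R_j = ℓ^{r₀}` exactly (`L = 1` in (2.5)), `p₀(g_j) = A₀ℓ^{p₀}`, `p₁(g_j) = A₁ℓ^{p₁}`,
and a live factor `λ₀` with `λ₀²A₁² < A₀`, the margin inequality `p₀(g_j) ≦ R_j^{−d−5}(λ₀p₁(g_j))²` of the companion's
`margin383_live` FAILS for EVERY `ℓ = log g_j⁻² > 0`: the left side of the kept factor's exponent is STRICTLY larger,
`R_j^{−d−5}(λ₀p₁(g_j))² = λ₀²A₁²ℓ^{p₀} < A₀ℓ^{p₀} = p₀(g_j)`.  Road (δ) therefore consumes exactly the strictness of the printed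
inequality «2p₁ − (d + 5)r₀ > p₀»; no smallness of `g_j` helps at the boundary.  (With print's «A₁∕A₀ sufficiently small»
the hypothesis `λ₀²A₁² < A₀` already holds at `λ₀ = 1`: at the boundary not even the UNSCALED factor is absorbed once the
amplitudes are counted — the strictness is consumed by print's own constants first, and the live factor merely joins them.)
[folklore] -/
theorem liveFactor_not_absorbed_at_boundary {ℓ p₀ p₁ r₀ A₀ A₁ lam₀ : ℝ} {d : ℕ} (hℓ : 0 < ℓ)
    (hA : lam₀ ^ 2 * A₁ ^ 2 < A₀) (hσ : p₀ = 2 * p₁ - (d + 5) * r₀) :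
    ((ℓ ^ r₀) ^ (d + 5))⁻¹ * (lam₀ * (A₁ * ℓ ^ p₁)) ^ 2 < A₀ * ℓ ^ p₀ := by
  have hR : (ℓ ^ r₀) ^ (d + 5) = ℓ ^ (((d : ℝ) + 5) * r₀) := by
    rw [rpow_pow_eq hℓ.le r₀ (d + 5)]; push_cast; ring_nf
  have hsq : (lam₀ * (A₁ * ℓ ^ p₁)) ^ 2 = lam₀ ^ 2 * A₁ ^ 2 * ℓ ^ (2 * p₁) := by
    rw [mul_pow, mul_pow, rpow_pow_eq hℓ.le p₁ 2]; push_cast; ring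
  have hsplit : ℓ ^ (2 * p₁) = ℓ ^ (((d : ℝ) + 5) * r₀) * ℓ ^ p₀ := by
    rw [← Real.rpow_add hℓ, hσ]; ring_nf
  have hpos : 0 < ℓ ^ (((d : ℝ) + 5) * r₀) := Real.rpow_pos_of_pos hℓ _
  have hp₀ : 0 < ℓ ^ p₀ := Real.rpow_pos_of_pos hℓ _
  rw [hR, hsq, hsplit]
  calc (ℓ ^ (((d : ℝ) + 5) * r₀))⁻¹ * (lam₀ ^ 2 * A₁ ^ 2 * (ℓ ^ (((d : ℝ) + 5) * r₀) * ℓ ^ p₀))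
      = lam₀ ^ 2 * A₁ ^ 2 * ℓ ^ p₀ := by field_simp
    _ < A₀ * ℓ ^ p₀ := mul_lt_mul_of_pos_right hA hp₀

/-- … in the currency of the factors: at the boundary, print's kept factor `exp(−p₀(g_j))` is STRICTLY SMALLER than the
lowered-threshold factor `exp(−R_j^{−d−5}(λ₀p₁(g_j))²)` for every `g_j` — the live factor is not estimated by it
(contrast the companion's `exp_neg_p0_of_proviso_live` under the strict proviso). [folklore] -/
theorem exp_kept_lt_exp_live_at_boundary {ℓ p₀ p₁ r₀ A₀ A₁ lam₀ : ℝ} {d : ℕ} (hℓ : 0 < ℓ)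
    (hA : lam₀ ^ 2 * A₁ ^ 2 < A₀) (hσ : p₀ = 2 * p₁ - (d + 5) * r₀) :
    Real.exp (-(A₀ * ℓ ^ p₀)) < Real.exp (-(((ℓ ^ r₀) ^ (d + 5))⁻¹ * (lam₀ * (A₁ * ℓ ^ p₁)) ^ 2)) :=
  Real.exp_lt_exp.mpr (neg_lt_neg (liveFactor_not_absorbed_at_boundary hℓ hA hσ))

/-- In particular the tree's pre-existing NON-strict reading (`Lit.B16Sect1Kernels.exp_lfFactor_le_exp_neg_p0`: amplitudes
`A₀ = A₁ = 1`, `μ = 1`) has no room for any live factor `λ₀ < 1`: at the boundary with unit amplitudes,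
`R_j^{−d−5}(λ₀p₁(g_j))² < p₀(g_j)` for every `g_j`. [folklore] -/
theorem unit_amplitudes_no_room_at_boundary {ℓ p₀ p₁ r₀ lam₀ : ℝ} {d : ℕ} (hℓ : 0 < ℓ) (h0 : 0 ≤ lam₀)
    (h1 : lam₀ < 1) (hσ : p₀ = 2 * p₁ - (d + 5) * r₀) :
    ((ℓ ^ r₀) ^ (d + 5))⁻¹ * (lam₀ * (1 * ℓ ^ p₁)) ^ 2 < 1 * ℓ ^ p₀ := by
  refine liveFactor_not_absorbed_at_boundary hℓ ?_ hσ
  have : lam₀ ^ 2 < 1 := by nlinarith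
  simpa using this

/-! ## §5. Sanity -/

/-- SANITY: the strict proviso of p. 383 and [B15] p. 183's «p₁ < p₀» are jointly inhabited in `d = 4` — `p₀ = p₁ = 10`,
`r₀ = 1`: `10 < 20 − 9` — and the exponent room for the printed cost exponent follows: `(4 + 2)·1 < 2·10`. [folklore] -/
example : ExponentProviso383 10 10 1 4 ∧ (4 + 2) * 1 < 2 * 10 := by
  refine ⟨?_, exponentRoom_of_proviso383 (p₀ := 10) (p₁ := 10) (r := 1) (d := 4) ?_ le_rfl⟩ <;>
    · unfold ExponentProviso383; norm_num

/-- SANITY (non-vacuity of §2's threshold statement on concrete constants): with `L = 2`, `W = 1`, `K_c = 1`,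
`A₀ = A₁ = 1`, `λ₀ = 1/2`, `n = 6`, `r = 1`, `p₀ = 10` the hypotheses of `locatedCondition385_of_g_small` hold, so a
threshold `g₀ > 0` exists. [folklore] -/
example : ∃ g₀ : ℝ, 0 < g₀ ∧ ∀ (g : ℝ) (R : ℕ), 0 < g → g ≤ g₀ → B14.IsRj 2 1 g R →
    2 * ((1 : ℝ) * (R : ℝ) ^ 6) ≤ 1 * ((1 / 2 : ℝ) * 1) ^ 2 * (p0Profile 1 10 g) ^ 2 :=
  locatedCondition385_of_g_small (L := 2) (r := 1) (p₀ := 10) (n := 6) (by norm_num) zero_le_one one_pos one_pos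
    one_pos (by norm_num) (by norm_num)

end

end Summit.QuantumFields.BalabanUV.T4Continuum.Spine.NE7c.LiveFactorKappaInduction
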